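import Summits.HodgeConjecture.HodgeConjecture.Theorems.SignSymmetricPowersGeneralPencil
import Literature.AlgebraicGeometry.FundamentalGroup.HypersurfaceComplementPencilDiscriminantFixedBaseSquarefree
import HarnessLib

/-!
# Route `SignSymmetricPowers` — EVERY smooth ι-even threefold lies on a good pencil (reading (a″)-B through every
# smooth member; modulo the quasi-projective Griffiths theorem)

Support file for crux K1-B (stmt-HodgeConjecture-19716; `--supports … --as helper`).  Prover seat `hodge-nonav-prover-Ax`
(g15), programme «FIXED-BASE BERTINI», sequel of `SignSymmetricPowersGeneralPencil`: there,
`hodgeConjectureFor_signPowers_offCountable_of_pencil` needs a pointed line `(f₀, g)` of ι-even forms transversal to the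
reduced ι-even discriminant (`pencilDiscr h′ (f₀, g) ≠ 0`); the fixed-base Bertini theorem
(`exists_eval_pencilDiscr_ne_zero_of_squarefree`, with `h′` squarefree BY ITS OWN OUTPUT `squarefree_of_pencilDiscr_ne_zero`)
supplies such a direction `g` through EVERY smooth ι-even `f₀`.  Hence the good pencils COVER the smooth ι-even forms:
every smooth ι-even threefold `X_{f₀}` of even degree `d ≥ 4` is the member `u = 0` of a pencil `f₀ + u·g` of ι-even forms
along which all but COUNTABLY many members have the Hodge conjecture on all self fibre powers — GRANTED Griffiths 1968
(QP form).  `X_{f₀}` itself may be among the countably many exceptions: this is NOT reading (b); items 19716 ∕ 19715 stay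
OPEN (hCDK); rung F-H1 not moved; HC ∕ HC_CM ∕ HC_AV not proved.

## References
* [Dimca1992] A. Dimca, *Singularities and Topology of Hypersurfaces* (1992), Ch. 4 §3 Prop. (3.1).
* [Deligne1972WeilK3] P. Deligne, La conjecture de Weil pour les surfaces K3, Invent. Math. 15 (1972), Prop. 7.5.
* [VoisinHodgeII2003] C. Voisin, *Hodge Theory and Complex Algebraic Geometry II*, §3.2.2 Thm. 3.22 and §6.2.1.
-/

noncomputable section

set_option linter.dupNamespace false

namespace Summit.HodgeConjecture.HodgeConjecture.Theorems.SignSymmetricPowersGeneralPencil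

open CategoryTheory CategoryTheory.Limits Set
open Literature.AlgebraicGeometry.Motives Literature.AlgebraicGeometry.HodgeTheory
open Literature.AlgebraicGeometry.Motives.UniversalHypersurface Literature.AlgebraicGeometry.HodgeTheory.UniversalHypersurface
open Literature.AlgebraicGeometry.HodgeTheory.MonomialPencil
open Literature.AlgebraicGeometry.FundamentalGroup
open Literature.AlgebraicGeometry.Motives.SmoothHypersurface (IsNonsingularForm)
open Summit.HodgeConjecture.HodgeConjecture.Theorems.SignSymmetricPowersConfluenceLinkG (isSupportedOn_of_coeff_odd_eq_zero)

/-- **A reduced equation of the ι-even discriminant, read through the coefficient chart**: for `d` even `≥ 4` there are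
a polynomial `h′` on the ι-even coefficients with `pencilDiscr h′ ≠ 0` (hence squarefree), vanishing at `0`, and a
homeomorphism `χ : S_{M_ι}(ℂ) ≃ₜ ℂ^{M_ι} ∖ V(h′)` reading the coefficients of the forms of points (extracted from the proof of
`signThreefoldPowersHodgeGeneralPencil_QP`). [cite: VoisinHodgeII2003, §6.2.1] [cite: Dimca1992, Ch. 4 §3 Prop. (3.1)] -/
theorem exists_reducedDiscriminant_chart {d : ℕ} (hd : Even d) (h4 : 4 ≤ d) :
    ∃ (h' : MvPolynomial {m : DegIndex 3 d | Even (m.1 0 + m.1 1)} ℂ)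
      (χ : ComplexPoints (baseM ℂ 3 d {m : DegIndex 3 d | Even (m.1 0 + m.1 1)}) ≃ₜ affineHypersurfaceComplement ![h']),
      (∀ (t : ComplexPoints (baseM ℂ 3 d {m : DegIndex 3 d | Even (m.1 0 + m.1 1)}))
          (m : {m : DegIndex 3 d | Even (m.1 0 + m.1 1)}),
          (χ t : {m : DegIndex 3 d | Even (m.1 0 + m.1 1)} → ℂ) m = MvPolynomial.coeff m.1.1 (pointFormM ℂ 3 d _ t)) ∧
      pencilDiscr h' ≠ 0 ∧ MvPolynomial.eval (0 : {m : DegIndex 3 d | Even (m.1 0 + m.1 1)} → ℂ) h' = 0 := by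
  classical
  obtain ⟨Disc, -, hDhom, hDpos, hV⟩ := exists_irreducible_isHomogeneous_discriminantForm (n := 3) (d := d) (by omega)
  have hrange := SignSymmetricPowersMeridianChart.range_coeffChart_eq 3 d {m : DegIndex 3 d | Even (m.1 0 + m.1 1)} hV
  obtain ⟨-, ⟨t₀⟩, -⟩ := SignSymmetricPowersFibreCoreB.stub_signFibreCoreC hd h4
  have ht₀ : MvPolynomial.eval ((coeffVector ℂ 3 d (AlgPoints.map (toBase ℂ 3 d {m : DegIndex 3 d | Even (m.1 0 + m.1 1)}) t₀)) ∘
      (Subtype.val : {m : DegIndex 3 d | Even (m.1 0 + m.1 1)} → DegIndex 3 d))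
      (killHom ℂ 3 d {m : DegIndex 3 d | Even (m.1 0 + m.1 1)} Disc) ≠ 0 := by
    have hm : (coeffVector ℂ 3 d (AlgPoints.map (toBase ℂ 3 d {m : DegIndex 3 d | Even (m.1 0 + m.1 1)}) t₀)) ∘
        (Subtype.val : {m : DegIndex 3 d | Even (m.1 0 + m.1 1)} → DegIndex 3 d) ∈
        Set.range (fun t : ComplexPoints (baseM ℂ 3 d {m : DegIndex 3 d | Even (m.1 0 + m.1 1)}) =>
          (coeffVector ℂ 3 d (AlgPoints.map (toBase ℂ 3 d {m : DegIndex 3 d | Even (m.1 0 + m.1 1)}) t)) ∘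
            (Subtype.val : {m : DegIndex 3 d | Even (m.1 0 + m.1 1)} → DegIndex 3 d)) := ⟨t₀, rfl⟩
    rw [hrange] at hm
    exact hm
  have hDM : killHom ℂ 3 d {m : DegIndex 3 d | Even (m.1 0 + m.1 1)} Disc ≠ 0 := fun h0 => ht₀ (by rw [h0, map_zero])
  obtain ⟨h', -, hz, hQ0⟩ := exists_sameZeros_pencilDiscr_ne_zero hDM
  have hrange' : Set.range (fun t : ComplexPoints (baseM ℂ 3 d {m : DegIndex 3 d | Even (m.1 0 + m.1 1)}) =>
      (coeffVector ℂ 3 d (AlgPoints.map (toBase ℂ 3 d {m : DegIndex 3 d | Even (m.1 0 + m.1 1)}) t)) ∘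
        (Subtype.val : {m : DegIndex 3 d | Even (m.1 0 + m.1 1)} → DegIndex 3 d)) = affineHypersurfaceComplement ![h'] := by
    rw [hrange]
    ext a
    rw [mem_setOf_eq, mem_affineHypersurfaceComplement_iff]
    constructor
    · intro ha j
      fin_cases j
      exact fun h0 => ha ((hz a).1 h0)
    · intro ha h0
      exact ha 0 ((hz a).2 h0)
  refine ⟨h', (SignSymmetricPowersMeridianChart.isEmbedding_coeffChart 3 d {m : DegIndex 3 d | Even (m.1 0 + m.1 1)}).toHomeomorph.trans
      (Homeomorph.setCongr hrange'), fun t m => ?_, hQ0, ?_⟩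
  · change coeffVector ℂ 3 d (AlgPoints.map (toBase ℂ 3 d {m : DegIndex 3 d | Even (m.1 0 + m.1 1)}) t) m.1 = _
    rw [coeffVector_apply]
  · exact (hz 0).2 (eval_zero_killHom_eq_zero _ hDhom hDpos)

/-- **Every smooth ι-even threefold lies on a good pencil** (modulo the quasi-projective Griffiths theorem and hN′): for
`d` even `≥ 4` and every ι-even homogeneous NONSINGULAR quinary form `f₀` of degree `d` there are an ι-even direction `g`
and a COUNTABLE `C ⊆ ℂ` such that for `u ∉ C` every smooth projective threefold cut out by `f₀ + u·g` has the Hodge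
conjecture on all self fibre powers. [cite: Dimca1992, Ch. 4 §3 Prop. (3.1)] [cite: Deligne1972WeilK3, Prop. 7.5]
[cite: VoisinHodgeII2003, §3.2.2 Thm. 3.22 and §6.2.1] -/
theorem exists_goodPencil_through_QP (hGr : Griffiths1968_holomorphicHodgeSubbundlesQP)
    (hNC : ∀ (n d : ℕ) (f₁ g₀ g₂ : MvPolynomial (Fin (n + 2)) ℂ) (j k : Fin (n + 2)) (a : Fin (n + 2) → ℂˣ),
      1 ≤ n → 1 ≤ d → Odd n → (∃ (i : Fin (n + 2)) (c : ℂ), g₀ = c • MvPolynomial.X i ^ d) →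
      f₁.IsHomogeneous d → g₀.IsHomogeneous d → g₂.IsHomogeneous d → IsSymmetricA3Datum f₁ g₀ g₂ j k a →
      ∀ (εa εb : ℝ) (ψ : ℂ → ℂ), IsSymmetricA3Bifurcation f₁ g₀ g₂ j a εa εb ψ →
        ∃ εa' : ℝ, 0 < εa' ∧ εa' ≤ εa ∧ SymmetricA3NonCommutation n d f₁ g₀ g₂ ψ εa')
    {d : ℕ} (hd : Even d) (h4 : 4 ≤ d) {F₀ : MvPolynomial (Fin 5) ℂ} (hF₀ : F₀.IsHomogeneous d)
    (hevF : ∀ e : Fin 5 →₀ ℕ, ¬ Even (e 0 + e 1) → F₀.coeff e = 0) (hJ : IsNonsingularForm ℂ F₀) :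
    ∃ G : MvPolynomial (Fin 5) ℂ, G.IsHomogeneous d ∧ (∀ e : Fin 5 →₀ ℕ, ¬ Even (e 0 + e 1) → G.coeff e = 0) ∧
      ∃ C : Set ℂ, C.Countable ∧ ∀ u : ℂ, u ∉ C →
        ∀ ⦃X : SchemeOver ℂ⦄, IsSmoothProjective 3 X → IsHypersurfaceCutOutBy 4 (F₀ + MvPolynomial.C u * G) X →
          ∀ ⦃k : ℕ⦄ ⦃Y : SchemeOver ℂ⦄, (∃ π : Fin (k + 1) → (Y ⟶ X), Nonempty (IsLimit (Fan.mk Y π))) →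
            HodgeConjectureFor (3 * (k + 1)) Y := by
  classical
  obtain ⟨h', χ, hχ, hQ0, hz0⟩ := exists_reducedDiscriminant_chart hd h4
  have hsq : Squarefree h' := squarefree_of_pencilDiscr_ne_zero hQ0
  have hMF : IsSupportedOn 3 d {m : DegIndex 3 d | Even (m.1 0 + m.1 1)} F₀ := isSupportedOn_of_coeff_odd_eq_zero hevF
  -- the ι-even coefficients of `F₀` lie in the complement `ℂ^M ∖ V(h′)`
  have hb : MvPolynomial.eval (coeffsM 3 d {m : DegIndex 3 d | Even (m.1 0 + m.1 1)} F₀) h' ≠ 0 := by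
    have heq : (χ (pointOfFormM ℂ 3 d _ hF₀ hJ hMF) : {m : DegIndex 3 d | Even (m.1 0 + m.1 1)} → ℂ) =
        coeffsM 3 d {m : DegIndex 3 d | Even (m.1 0 + m.1 1)} F₀ :=
      funext fun m => by rw [hχ, pointFormM_pointOfFormM]
    have hmem := (χ (pointOfFormM ℂ 3 d _ hF₀ hJ hMF)).2
    rw [heq, mem_affineHypersurfaceComplement_iff] at hmem
    exact hmem 0
  -- fixed-base Bertini: a transversal direction through `F₀`
  obtain ⟨v, hv⟩ := exists_eval_pencilDiscr_ne_zero_of_squarefree hsq hb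
  let ext : ({m : DegIndex 3 d | Even (m.1 0 + m.1 1)} → ℂ) → (DegIndex 3 d → ℂ) := fun a m =>
    if hm : m ∈ {m : DegIndex 3 d | Even (m.1 0 + m.1 1)} then a ⟨m, hm⟩ else 0
  have hevG : ∀ e : Fin 5 →₀ ℕ, ¬ Even (e 0 + e 1) → (formOfCoeffs (ext v)).coeff e = 0 := by
    intro e he
    by_cases hdeg : e.degree = d
    · have h1 := coeff_formOfCoeffs (ext v) ⟨e, hdeg⟩
      change MvPolynomial.coeff e (formOfCoeffs (ext v)) = _ at h1
      rw [h1]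
      exact dif_neg he
    · exact coeff_formOfCoeffs_of_degree_ne (ext v) hdeg
  have hcoe : coeffsM 3 d {m : DegIndex 3 d | Even (m.1 0 + m.1 1)} (formOfCoeffs (ext v)) = v := by
    funext m
    have h1 := coeff_formOfCoeffs (ext v) m.1
    change MvPolynomial.coeff m.1.1 (formOfCoeffs (ext v)) = _ at h1
    change MvPolynomial.coeff m.1.1 (formOfCoeffs (ext v)) = v m
    rw [h1]
    exact (dif_pos m.2).trans rfl
  have hg : coeffsM 3 d {m : DegIndex 3 d | Even (m.1 0 + m.1 1)} (formOfCoeffs (ext v)) ≠ 0 := by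
    rw [hcoe]
    exact ne_zero_of_pencilDiscr_of_zeros (h := h') (h' := h') (fun _ => Iff.rfl) hz0 hb hv
  refine ⟨formOfCoeffs (ext v), isHomogeneous_formOfCoeffs _, hevG,
    hodgeConjectureFor_signPowers_offCountable_of_pencil hGr hNC hd h4 χ hχ hF₀ (isHomogeneous_formOfCoeffs _) hevF hevG hg ?_⟩
  rw [hcoe]
  exact hv

/-- **Every smooth ι-even threefold lies on a good pencil, granted the quasi-projective Griffiths theorem ONLY**
(hN′ := `WeightedPencil.symmetricA3NonCommutation_mono_holds`). [cite: Dimca1992, Ch. 4 §3 Prop. (3.1)]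
[cite: Deligne1972WeilK3, Prop. 7.5] [cite: VoisinHodgeII2003, §3.2.2 Thm. 3.22 and §6.2.1] -/
theorem exists_goodPencil_through_of_griffithsQP (hGr : Griffiths1968_holomorphicHodgeSubbundlesQP)
    {d : ℕ} (hd : Even d) (h4 : 4 ≤ d) {F₀ : MvPolynomial (Fin 5) ℂ} (hF₀ : F₀.IsHomogeneous d)
    (hevF : ∀ e : Fin 5 →₀ ℕ, ¬ Even (e 0 + e 1) → F₀.coeff e = 0) (hJ : IsNonsingularForm ℂ F₀) :
    ∃ G : MvPolynomial (Fin 5) ℂ, G.IsHomogeneous d ∧ (∀ e : Fin 5 →₀ ℕ, ¬ Even (e 0 + e 1) → G.coeff e = 0) ∧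
      ∃ C : Set ℂ, C.Countable ∧ ∀ u : ℂ, u ∉ C →
        ∀ ⦃X : SchemeOver ℂ⦄, IsSmoothProjective 3 X → IsHypersurfaceCutOutBy 4 (F₀ + MvPolynomial.C u * G) X →
          ∀ ⦃k : ℕ⦄ ⦃Y : SchemeOver ℂ⦄, (∃ π : Fin (k + 1) → (Y ⟶ X), Nonempty (IsLimit (Fan.mk Y π))) →
            HodgeConjectureFor (3 * (k + 1)) Y :=
  exists_goodPencil_through_QP hGr WeightedPencil.symmetricA3NonCommutation_mono_holds hd h4 hF₀ hevF hJ

/-- **Every smooth ι-even threefold lies on a good pencil, granted Griffiths 1968 ONLY** (tier t2 of reading (a″)-B,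
now through every smooth member). [cite: Dimca1992, Ch. 4 §3 Prop. (3.1)] [cite: Deligne1972WeilK3, Prop. 7.5]
[cite: VoisinHodgeII2003, §3.2.2 Thm. 3.22 and §6.2.1] -/
theorem exists_goodPencil_through_of_griffiths (hGr : Griffiths1968_holomorphicHodgeSubbundles)
    {d : ℕ} (hd : Even d) (h4 : 4 ≤ d) {F₀ : MvPolynomial (Fin 5) ℂ} (hF₀ : F₀.IsHomogeneous d)
    (hevF : ∀ e : Fin 5 →₀ ℕ, ¬ Even (e 0 + e 1) → F₀.coeff e = 0) (hJ : IsNonsingularForm ℂ F₀) :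
    ∃ G : MvPolynomial (Fin 5) ℂ, G.IsHomogeneous d ∧ (∀ e : Fin 5 →₀ ℕ, ¬ Even (e 0 + e 1) → G.coeff e = 0) ∧
      ∃ C : Set ℂ, C.Countable ∧ ∀ u : ℂ, u ∉ C →
        ∀ ⦃X : SchemeOver ℂ⦄, IsSmoothProjective 3 X → IsHypersurfaceCutOutBy 4 (F₀ + MvPolynomial.C u * G) X →
          ∀ ⦃k : ℕ⦄ ⦃Y : SchemeOver ℂ⦄, (∃ π : Fin (k + 1) → (Y ⟶ X), Nonempty (IsLimit (Fan.mk Y π))) →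
            HodgeConjectureFor (3 * (k + 1)) Y :=
  exists_goodPencil_through_of_griffithsQP (griffiths1968QP_of_griffiths1968 hGr) hd h4 hF₀ hevF hJ

end Summit.HodgeConjecture.HodgeConjecture.Theorems.SignSymmetricPowersGeneralPencil

end
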